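import Summits.Parity.BatemanHorn.Theses.AlmostPrimeZeros
import Summits.Parity.BatemanHorn.Theorems.DiscMajorantLog.Negative.FalseWithoutPairwise

/-!
# Crux `DiscMajorantLog` (stmt-Parity-17114) — every clause of `IsBatemanHornSystem` is load-bearing

Negative-side theorems (standing disprover `cdisprove-stmt-Parity-17114`, 2026-08-17) for the near leaf
`Summit.Parity.BatemanHorn.Theses.AlmostPrimeZeros.DiscMajorantLog` of route `AlmostPrimeZeros`:

  `∀ (k,f) BH, ∃ A C x₀, ∀ x ≥ x₀, ∀ z, ‖z − 1‖ ≤ 3 log log x →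
     ‖Σ_{n≤x} z^{s_f(n)}‖ ≤ A·x·(log x)^{k(Re z − 1)}·exp(C‖z−1‖ log(‖z−1‖+2))`.

Companion of `FalseWithoutPairwise.lean` (p136416: drop `pairwise_not_associated` ⇒ false via `(X, X)`).
Here the three remaining clauses:

* `majorantBody_false_of_norm_at_neg_one` — the ENGINE: for `k ≥ 1`, any exponent sequence of constant
  parity (`‖Σ_{n≤x} (−1)^{e n}‖ = x + 1`) violates the body at `z = −1`, where the budget is
  `A e^{2C log 4} x (log x)^{−2k} = o(x)`;
* `discMajorantLog_false_without_irreducible` — drop `irreducible`, even keeping every member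
  NON-CONSTANT: witness `![X²]` (statistic `2ω(n)`, even);
* `discMajorantLog_false_without_leadingCoeff_pos` — drop `leadingCoeff_pos`: witness `![−X]`
  (values `≤ 0` are discarded by `Int.toNat`, statistic `0`);
* `discMajorantLog_false_without_hasNoFixedPrimeDivisor` — drop `hasNoFixedPrimeDivisor`: witness the
  prime constant `![C 2]` (statistic `1`).  Hypothesis-mutation remark: among NON-CONSTANT systems this
  clause is plausibly not load-bearing for the leaf itself (`(X, X+1)` keeps a polynomial local factor
  `E₂(z) = (z+z²)/2` with `E₂(1) = 1`); it is load-bearing for the route's extraction step.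

So every proof of the near leaf must use each clause of `IsBatemanHornSystem`; the parity of the
statistic (not only its mean `k log log x`) is what irreducibility and non-association protect.
-/

noncomputable section


namespace Summit.Parity.BatemanHorn.Theorems.DiscMajorantLog.Negative

open Polynomial
open Literature.NumberTheory.Sieve
open Summit.Parity.BatemanHorn.Theorems.SystemZeroRepulsion.Negative

/-- ENGINE (constant parity kills the majorant).  If `k ≥ 1` and the exponent sequence `e` satisfies
`‖Σ_{n≤x} (−1)^{e n}‖ = x + 1` for every `x` (all `e n` even, or all odd), then the body of
`DiscMajorantLog` fails for `(k, e)`: at `z = −1` (in the disc once `x ≥ 16`) it reads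
`(x+1)(log x)^{2k} ≤ A e^{2C log 4} x`, impossible for `log x ≥ |A e^{2C log 4}| + 1`. [folklore] -/
theorem majorantBody_false_of_norm_at_neg_one {k : ℕ} (hk : 1 ≤ k) {e : ℕ → ℕ}
    (he : ∀ x : ℕ, ‖∑ n ∈ Finset.range (x + 1), (-1 : ℂ) ^ (e n)‖ = (x : ℝ) + 1) :
    ¬ ∃ A C : ℝ, ∃ x₀ : ℕ, ∀ x : ℕ, x₀ ≤ x → ∀ z : ℂ, ‖z - 1‖ ≤ 3 * Real.log (Real.log (x : ℝ)) →
      ‖(∑ n ∈ Finset.range (x + 1), (z : ℂ) ^ (e n))‖ ≤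
        A * (x : ℝ) * (Real.log (x : ℝ)) ^ ((k : ℝ) * ((z : ℂ).re - 1)) *
          Real.exp (C * ‖(z : ℂ) - 1‖ * Real.log (‖(z : ℂ) - 1‖ + 2)) := by
  rintro ⟨A, C, x₀, h⟩
  set E : ℝ := Real.exp (C * 2 * Real.log (2 + 2)) with hE
  set K : ℝ := A * E with hK
  set x : ℕ := max (max x₀ 16) ⌈Real.exp (|K| + 1)⌉₊ with hxdef
  have hx₀ : x₀ ≤ x := le_trans (le_max_left _ _) (le_max_left _ _)
  have hx16 : (16 : ℝ) ≤ x := by exact_mod_cast le_trans (le_max_right x₀ 16) (le_max_left _ _)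
  have hxpos : (0 : ℝ) < x := by linarith
  have hxK : Real.exp (|K| + 1) ≤ x := le_trans (Nat.le_ceil _) (by exact_mod_cast le_max_right _ _)
  obtain ⟨h23, hlogx⟩ := two_le_three_loglog_of_sixteen_le hx16
  have hlogK : |K| + 1 ≤ Real.log x := by rw [Real.le_log_iff_exp_le hxpos]; exact hxK
  have hlog1 : 1 ≤ Real.log x := by linarith [abs_nonneg K]
  have hlog2 : Real.log x ≤ Real.log x ^ 2 := le_self_pow₀ hlog1 (by norm_num)
  have hpow2k : Real.log (x : ℝ) ^ 2 ≤ Real.log x ^ (2 * k) := pow_le_pow_right₀ hlog1 (by omega)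
  have hz : ‖(-1 : ℂ) - 1‖ ≤ 3 * Real.log (Real.log (x : ℝ)) := by
    rw [show (-1 : ℂ) - 1 = -2 by norm_num, norm_neg, Complex.norm_two]; exact h23
  have hmain := h x hx₀ (-1) hz
  rw [he x, show (-1 : ℂ) - 1 = -2 by norm_num, norm_neg, Complex.norm_two] at hmain
  have hre : (k : ℝ) * ((-1 : ℂ).re - 1) = -((2 * k : ℕ) : ℝ) := by simp; ring
  rw [hre, Real.rpow_neg hlogx.le, Real.rpow_natCast] at hmain
  have hpow : 0 < Real.log (x : ℝ) ^ (2 * k) := pow_pos hlogx _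
  have h1 : ((x : ℝ) + 1) * Real.log (x : ℝ) ^ (2 * k) ≤ K * x := by
    have := mul_le_mul_of_nonneg_right hmain hpow.le
    rw [hK]
    calc ((x : ℝ) + 1) * Real.log (x : ℝ) ^ (2 * k)
        ≤ A * x * (Real.log (x : ℝ) ^ (2 * k))⁻¹ * E * Real.log (x : ℝ) ^ (2 * k) := this
      _ = A * E * x := by field_simp
  have h2 : ((x : ℝ) + 1) * Real.log (x : ℝ) ^ 2 ≤ K * x :=
    (mul_le_mul_of_nonneg_left hpow2k (by positivity)).trans h1
  rcases le_or_gt K 0 with hK0 | hK0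
  · have : ((x : ℝ) + 1) * Real.log (x : ℝ) ^ 2 ≤ 0 :=
      h2.trans (mul_nonpos_of_nonpos_of_nonneg hK0 hxpos.le)
    nlinarith
  · have h3 : Real.log (x : ℝ) ^ 2 ≤ K := by
      by_contra hcon
      push Not at hcon
      nlinarith
    have : K ≤ |K| := le_abs_self K
    linarith

/-- Norm bookkeeping: a sum of `x + 1` ones, resp. minus ones, has norm `x + 1`. [folklore] -/
theorem norm_sum_range_const_one (x : ℕ) :
    ‖∑ _n ∈ Finset.range (x + 1), (1 : ℂ)‖ = (x : ℝ) + 1 := by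
  simp only [Finset.sum_const, Finset.card_range, nsmul_eq_mul, mul_one]
  rw [show ((x + 1 : ℕ) : ℂ) = ((x + 1 : ℕ) : ℝ) by push_cast; rfl, Complex.norm_real,
    Real.norm_of_nonneg (by positivity)]
  push_cast; ring

/-! ## `irreducible` is load-bearing — even among NON-CONSTANT members (witness `X²`) -/

/-- For the family `![X²]` the alternating sum is `x + 1` (the statistic `2ω(n)` is even). [folklore] -/
theorem sqX_norm_at_neg_one (x : ℕ) :
    ‖∑ n ∈ Finset.range (x + 1), (-1 : ℂ) ^
        (∑ i : Fin 1, ((((![X ^ 2] : Fin 1 → ℤ[X]) i).eval (n : ℤ)).toNat.factorization.sum fun _ v => min v 2))‖ =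
      (x : ℝ) + 1 := by
  have : ∀ n ∈ Finset.range (x + 1), (-1 : ℂ) ^
      (∑ i : Fin 1, ((((![X ^ 2] : Fin 1 → ℤ[X]) i).eval (n : ℤ)).toNat.factorization.sum fun _ v => min v 2)) = 1 := by
    intro n _
    rw [sqX_exponent, pow_mul]; simp
  rw [Finset.sum_congr rfl this, norm_sum_range_const_one]

/-- DROP `irreducible` ⇒ `DiscMajorantLog` is FALSE, even if every member is required to be NON-CONSTANT
(so the failure is not an artefact of constants): witness `k = 1`, `f = ![X²]` (leading coefficient
`1 > 0`, vacuously pairwise non-associated, `ω(p) = 1 < p`, degree `2`), whose statistic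
`Σ_{p ∣ n} min(2 v_p(n), 2) = 2ω(n)` is even, so `S_x(−1) = x + 1 ≠ O(x (log x)^{−2})`.  Any proof of the
near leaf must use irreducibility — through the parity of the statistic, not only through the mean
`k log log x` (which `X²` also has, with `k log log x` replaced by `2 log log x`). [folklore] -/
theorem discMajorantLog_false_without_irreducible :
    ¬ ∀ (k : ℕ) (f : Fin k → ℤ[X]), (∀ i, 0 < (f i).natDegree) → (∀ i, 0 < (f i).leadingCoeff) →
      (Pairwise fun i j => ¬Associated (f i) (f j)) → HasNoFixedPrimeDivisor f →
      ∃ A C : ℝ, ∃ x₀ : ℕ, ∀ x : ℕ, x₀ ≤ x → ∀ z : ℂ, ‖z - 1‖ ≤ 3 * Real.log (Real.log (x : ℝ)) →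
        ‖(∑ n ∈ Finset.range (x + 1), (z : ℂ) ^ (∑ i, (((f i).eval (n : ℤ)).toNat.factorization.sum fun _ v => min v 2)))‖ ≤
          A * (x : ℝ) * (Real.log (x : ℝ)) ^ ((k : ℝ) * ((z : ℂ).re - 1)) *
            Real.exp (C * ‖(z : ℂ) - 1‖ * Real.log (‖(z : ℂ) - 1‖ + 2)) := by
  intro h
  have hdeg : ∀ i : Fin 1, 0 < ((![X ^ 2] : Fin 1 → ℤ[X]) i).natDegree := by
    intro i; fin_cases i; simp
  exact majorantBody_false_of_norm_at_neg_one le_rfl sqX_norm_at_neg_one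
    (h 1 ![X ^ 2] hdeg sqX_leadingCoeff_pos sqX_pairwise sqX_hasNoFixedPrimeDivisor)

/-! ## `leadingCoeff_pos` is load-bearing (witness `−X`) -/

/-- `−X` is irreducible (associated to `X`). [folklore] -/
theorem negX_irreducible : ∀ i : Fin 1, Irreducible ((![-X] : Fin 1 → ℤ[X]) i) := by
  intro i; fin_cases i
  simpa using ((Associated.refl (X : ℤ[X])).neg_left).symm.irreducible irreducible_X

/-- `![−X]` is (vacuously) pairwise non-associated. [folklore] -/
theorem negX_pairwise : Pairwise fun i j : Fin 1 => ¬Associated ((![-X] : Fin 1 → ℤ[X]) i) ((![-X]) j) :=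
  fun i j hij => absurd (Subsingleton.elim i j) hij

/-- `![−X]` has no fixed prime divisor: `p ∣ −n` with `0 ≤ n < p` forces `n = 0`, so `ω(p) ≤ 1 < p`. [folklore] -/
theorem negX_hasNoFixedPrimeDivisor : HasNoFixedPrimeDivisor (![-X] : Fin 1 → ℤ[X]) := by
  intro p hp
  unfold polyRootCountMod
  have hsub : ((Finset.range p).filter fun n : ℕ => (p : ℤ) ∣ ∏ i, ((![-X] : Fin 1 → ℤ[X]) i).eval (n : ℤ)) ⊆
      {0} := by
    intro n hn
    simp only [Finset.mem_filter, Finset.mem_range, Fin.prod_univ_one, Matrix.cons_val_fin_one, eval_neg,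
      eval_X, dvd_neg] at hn
    obtain ⟨hnp, hdvd⟩ := hn
    have h3 : n = 0 := Nat.eq_zero_of_dvd_of_lt (Int.natCast_dvd_natCast.mp hdvd) hnp
    simp [h3]
  calc ((Finset.range p).filter fun n : ℕ => (p : ℤ) ∣ ∏ i, ((![-X] : Fin 1 → ℤ[X]) i).eval (n : ℤ)).card
      ≤ ({0} : Finset ℕ).card := Finset.card_le_card hsub
    _ = 1 := Finset.card_singleton 0
    _ < p := hp.one_lt

/-- The statistic of `![−X]` vanishes identically (`(−n).toNat = 0`), so the alternating sum is `x + 1`. [folklore] -/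
theorem negX_norm_at_neg_one (x : ℕ) :
    ‖∑ n ∈ Finset.range (x + 1), (-1 : ℂ) ^
        (∑ i : Fin 1, ((((![-X] : Fin 1 → ℤ[X]) i).eval (n : ℤ)).toNat.factorization.sum fun _ v => min v 2))‖ =
      (x : ℝ) + 1 := by
  have : ∀ n ∈ Finset.range (x + 1), (-1 : ℂ) ^
      (∑ i : Fin 1, ((((![-X] : Fin 1 → ℤ[X]) i).eval (n : ℤ)).toNat.factorization.sum fun _ v => min v 2)) = 1 := by
    intro n _
    simp
  rw [Finset.sum_congr rfl this, norm_sum_range_const_one]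

/-- DROP `leadingCoeff_pos` ⇒ `DiscMajorantLog` is FALSE: witness `k = 1`, `f = ![−X]` (irreducible,
vacuously pairwise non-associated, `ω(p) = 1 < p`, non-constant); its values `−n ≤ 0` are discarded by
`Int.toNat`, the statistic is `0`, `S_x(z) = x + 1` for every `z`, and at `z = −1` the majorant asks
`x + 1 = O(x (log x)^{−2})`.  (The sign convention `f_i(n) ≤ 0 ↦ 0` of the route is what makes this clause
load-bearing; with `|f_i(n)|` in the statistic `−X` would behave like `X`.) [folklore] -/
theorem discMajorantLog_false_without_leadingCoeff_pos :
    ¬ ∀ (k : ℕ) (f : Fin k → ℤ[X]), (∀ i, 0 < (f i).natDegree) → (∀ i, Irreducible (f i)) →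
      (Pairwise fun i j => ¬Associated (f i) (f j)) → HasNoFixedPrimeDivisor f →
      ∃ A C : ℝ, ∃ x₀ : ℕ, ∀ x : ℕ, x₀ ≤ x → ∀ z : ℂ, ‖z - 1‖ ≤ 3 * Real.log (Real.log (x : ℝ)) →
        ‖(∑ n ∈ Finset.range (x + 1), (z : ℂ) ^ (∑ i, (((f i).eval (n : ℤ)).toNat.factorization.sum fun _ v => min v 2)))‖ ≤
          A * (x : ℝ) * (Real.log (x : ℝ)) ^ ((k : ℝ) * ((z : ℂ).re - 1)) *
            Real.exp (C * ‖(z : ℂ) - 1‖ * Real.log (‖(z : ℂ) - 1‖ + 2)) := by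
  intro h
  have hdeg : ∀ i : Fin 1, 0 < ((![-X] : Fin 1 → ℤ[X]) i).natDegree := by
    intro i; fin_cases i; simp
  exact majorantBody_false_of_norm_at_neg_one le_rfl negX_norm_at_neg_one
    (h 1 ![-X] hdeg negX_irreducible negX_pairwise negX_hasNoFixedPrimeDivisor)

/-! ## `hasNoFixedPrimeDivisor` is load-bearing — but only through CONSTANTS (witness `C 2`) -/

/-- The prime constant `2` is irreducible in `ℤ[X]`. [folklore] -/
theorem constTwo_irreducible : ∀ i : Fin 1, Irreducible ((![C 2] : Fin 1 → ℤ[X]) i) := by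
  intro i; fin_cases i
  simpa using (Polynomial.prime_C_iff.mpr Int.prime_two).irreducible

/-- The constant `2` has positive leading coefficient. [folklore] -/
theorem constTwo_leadingCoeff_pos : ∀ i : Fin 1, 0 < ((![C 2] : Fin 1 → ℤ[X]) i).leadingCoeff := by
  intro i; fin_cases i
  show 0 < (C (2 : ℤ)).leadingCoeff
  rw [leadingCoeff_C]; norm_num

/-- `![C 2]` is (vacuously) pairwise non-associated. [folklore] -/
theorem constTwo_pairwise : Pairwise fun i j : Fin 1 => ¬Associated ((![C 2] : Fin 1 → ℤ[X]) i) ((![C 2]) j) :=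
  fun i j hij => absurd (Subsingleton.elim i j) hij

/-- The statistic of `![C 2]` is identically `1` (`2 = 2¹`), so the alternating sum is `−(x + 1)`. [folklore] -/
theorem constTwo_norm_at_neg_one (x : ℕ) :
    ‖∑ n ∈ Finset.range (x + 1), (-1 : ℂ) ^
        (∑ i : Fin 1, ((((![C 2] : Fin 1 → ℤ[X]) i).eval (n : ℤ)).toNat.factorization.sum fun _ v => min v 2))‖ =
      (x : ℝ) + 1 := by
  have h2 : ((2 : ℕ)).factorization.sum (fun _ v => min v 2) = 1 := by
    rw [Nat.Prime.factorization Nat.prime_two, Finsupp.sum_single_index (by simp)]; simp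
  have : ∀ n ∈ Finset.range (x + 1), (-1 : ℂ) ^
      (∑ i : Fin 1, ((((![C 2] : Fin 1 → ℤ[X]) i).eval (n : ℤ)).toNat.factorization.sum fun _ v => min v 2)) = -1 := by
    intro n _
    simp [h2]
  rw [Finset.sum_congr rfl this, Finset.sum_neg_distrib, norm_neg, norm_sum_range_const_one]

/-- DROP `hasNoFixedPrimeDivisor` ⇒ `DiscMajorantLog` is FALSE: witness `k = 1`, `f = ![C 2]` (the prime
constant `2` is irreducible in `ℤ[X]`, has leading coefficient `2 > 0`, and is vacuously pairwise
non-associated; its fixed prime divisor is `2`): the statistic is identically `1`, `S_x(−1) = −(x+1)`.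
REMARK (hypothesis mutation): among NON-CONSTANT systems the clause is plausibly NOT load-bearing for the
majorant itself — e.g. for `(X, X+1)` (fixed prime divisor `2`) the LSD heuristic still predicts the
majorant, with local factor `E₂(z) = (z + z²)/2`, `E₂(1) = 1`; the clause is load-bearing for the ROUTE
(extraction of the prime count), not visibly for this leaf. [folklore] -/
theorem discMajorantLog_false_without_hasNoFixedPrimeDivisor :
    ¬ ∀ (k : ℕ) (f : Fin k → ℤ[X]), (∀ i, Irreducible (f i)) → (∀ i, 0 < (f i).leadingCoeff) →
      (Pairwise fun i j => ¬Associated (f i) (f j)) →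
      ∃ A C : ℝ, ∃ x₀ : ℕ, ∀ x : ℕ, x₀ ≤ x → ∀ z : ℂ, ‖z - 1‖ ≤ 3 * Real.log (Real.log (x : ℝ)) →
        ‖(∑ n ∈ Finset.range (x + 1), (z : ℂ) ^ (∑ i, (((f i).eval (n : ℤ)).toNat.factorization.sum fun _ v => min v 2)))‖ ≤
          A * (x : ℝ) * (Real.log (x : ℝ)) ^ ((k : ℝ) * ((z : ℂ).re - 1)) *
            Real.exp (C * ‖(z : ℂ) - 1‖ * Real.log (‖(z : ℂ) - 1‖ + 2)) := by
  intro h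
  exact majorantBody_false_of_norm_at_neg_one le_rfl constTwo_norm_at_neg_one
    (h 1 ![C 2] constTwo_irreducible constTwo_leadingCoeff_pos constTwo_pairwise)

end Summit.Parity.BatemanHorn.Theorems.DiscMajorantLog.Negative
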